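import Literature.NumberTheory.Automorphic.AutomorphicGLn
import Literature.NumberTheory.Automorphic.FlathBaseVector
import Literature.NumberTheory.Automorphic.RestrictedTensorProductProofs
import Literature.NumberTheory.Automorphic.RestrictedTensorProductIrreducibleProofs
import Mathlib.Data.Finset.NoncommProd
import HarnessLib

/-!
# Flath's tensor product theorem, existence half (proof of `flath_exists` for topological groups)

Topic `NumberTheory/Automorphic`; proof file for the named fact
`Literature.NumberTheory.Automorphic.flath_exists` of `AutomorphicGLn` (**lang.S19**; Flath,
*Decomposition of representations into tensor products*, Proc. Sympos. Pure Math. 33 (1979),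
part 1, Thm. 3 with Thm. 2 and Example 2; Bump, *Automorphic forms and representations* (1997),
§3.4, Thm. 3.4.2, Prop. 3.4.9, Thm. 3.4.4): every irreducible admissible representation `π` of a
restricted product `Γ = Πʳ i, [G i, K i]` of topological groups with respect to compact open
subgroups, `(G i, K i)` a Gelfand pair for almost all `i`, is a restricted tensor product
`π ≅ ⊗'_i (ρ i, x₀ i)` of irreducible admissible representations, almost all spherical
(`flath_exists_holds_of_isTopologicalGroup : flath_exists` under `[∀ i, IsTopologicalGroup (G i)]`).
(The uniqueness half, `flath_unique_holds`, is the sibling `AutomorphicGLnFlathProofs`; the files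
`FlathLocalLemmas` and `FlathBaseVector` announce the present file under that name, which was taken
by the uniqueness half in the meantime.)

**On the statement of `flath_exists`.** The constant `flath_exists` carries no hypothesis tying
the topology of `G i` to its group law: the section of `AutomorphicGLn` declares
`[∀ i, NonarchimedeanGroup (G i)] [∀ i, LocallyCompactSpace (G i)] [∀ i, T2Space (G i)]`
("locally profinite", as its docstring says), but a `def` only absorbs the section variables its
body uses, so these binders were dropped and the constant quantifies over arbitrary topological
spaces on the `G i`. The source's theorem (totally disconnected locally compact groups) and the
proof below need translations to be continuous (finite index of open subgroups in the compact
`K i`; finiteness of `K_i g K_i / K_i`; compact open boxes inside open subgroups). We therefore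
prove `flath_exists` for all families of *topological groups*
(`flath_exists_holds_of_isTopologicalGroup`); the corrected closed form
`flath_exists_of_isTopologicalGroup := ∀ [∀ i, IsTopologicalGroup (G i)], flath_exists` is
recorded and discharged in the sibling `AutomorphicGLnFlathExistsCorrected`. Whether the binder-free
constant is provable for non-group topologies is left open (no use is known).

## The proof

The local data come from `FlathBaseVector.exists_flathBaseVector`: a compact open box `U = ∏ L i`
and a non-zero `w⋆ ∈ W^U` whose cyclic `G i`-modules `C_i = span {π(ι_i g) w⋆} ≤ W`
(`ι_i = mulSingleHom K i`) are irreducible for every `i` and satisfy `C_i ∩ W^{ι_i K_i} = ℂ w⋆`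
for almost all `i`. We take `V i = C_i` (a subspace of `W`, so in the universe of `W`),
`ρ i = π ∘ ι_i` restricted to `C_i`, `x₀ i = w⋆` for *all* `i`, and
`j x = (∏_{i : x i ≠ w⋆} T_i) w⋆`, where `T_i` is any element of the coordinate algebra
`A_i = span {π(ι_i g)} ⊆ End W` with `T_i w⋆ = x i` (`Finset.noncommProd`; the `A_i` commute with
one another, `mul_comm_of_mem_coordSpan`). Then:

* `j` is well defined and restricted-multilinear: the product does not depend on the
  representatives `T_i` nor on enlarging the finite set (`noncommProd_apply_eq_of_apply_eq`:
  move one factor to act first on `w⋆`), and each `A_i` is a linear space;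
* `j` is equivariant: for `γ ∈ Γ` split `γ = γ_F · γ^F` with `γ_F = ∏_{i ∈ F} ι_i(γ i)` and
  `γ^F ∈ U` trivial on the finite set `F`; `γ^F` fixes `w⋆` and commutes with the `T_i`, `i ∈ F`;
* the finite-level maps `⨂_{i ∈ S} C_i → W` are injective for *every* finite `S` (so `S₀ = ∅`):
  their kernels are `∏_{i ∈ S} G i`-stable (`IsRestrictedMultilinear.liftFinset_map_eq`), the
  `C_i` are irreducible admissible, hence `⨂_{i ∈ S} C_i` has no proper non-zero stable subspace
  (`piTensorProduct_submodule_eq_top`, Schur + Jacobson density, from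
  `RestrictedTensorProductIrreducibleProofs`), and `j x₀ = w⋆ ≠ 0`;
* the ranges exhaust `W`: their union is the `π`-stable span of the values of `j`, non-zero, and
  `π` is irreducible;
* `ρ i` is irreducible (the `C_i` are), admissible (`C_i^{L'} ⊆ W^{∏_{j≠i} L_j × L'}`, finite
  dimensional by admissibility of `π`; smooth since `ι_i` is continuous) and, for almost all `i`,
  spherical with `x₀ i = w⋆ ≠ 0` a `K i`-fixed vector.

This is Flath's theorem as vendored (abstract finite-adelic form, Gelfand-pair hypothesis = the
commutativity hypothesis of Flath's Thm. 2); the route through simultaneous eigenvectors instead of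
Bump's spherical idempotents answers Bump's Exercise 3.4.6.

## References

* D. Flath, *Decomposition of representations into tensor products*, Proc. Sympos. Pure Math. 33
  (1979), part 1, 179–183, Thm. 2, Thm. 3, Example 2 [FlathCorvallis1979].
* D. Bump, *Automorphic forms and representations*, Cambridge Stud. Adv. Math. 55 (1997), §3.4,
  pp. 301–317 [Bump1997].
-/

noncomputable section

open scoped RestrictedProduct TensorProduct
open Filter MulAction PiTensorProduct Function
open _root_.Topology

namespace Literature.NumberTheory.Automorphic

universe u v w uk

/-! ### Subrepresentations: irreducibility, smoothness, fixed vectors on the subtype -/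

section Subrep

variable {k H W : Type*} [Field k] [Group H] [AddCommGroup W] [Module k W]
  {σ : Representation k H W} (C : Subrepresentation σ)

/-- A vector of a subrepresentation is `L`-fixed iff it is `L`-fixed in the ambient
representation. [folklore] -/
theorem mem_fixedPoints_toRepresentation_iff (L : Subgroup H)
    (v : C.toSubmodule) :
    v ∈ C.toRepresentation.fixedPoints L ↔ (v : W) ∈ σ.fixedPoints L := by
  simp only [Representation.mem_fixedPoints, Subrepresentation.toRepresentation, MonoidHom.coe_mk,
    OneHom.coe_mk, Subtype.ext_iff, LinearMap.coe_restrict_apply]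

/-- The `L`-fixed vectors of a subrepresentation `C` are `C ∩ W^L`: a linear equivalence
(stated as `Nonempty`, the file being theorems-only). [folklore] -/
theorem nonempty_fixedPoints_toRepresentation_equiv (L : Subgroup H) :
    Nonempty (↥(C.toRepresentation.fixedPoints L) ≃ₗ[k] ↥(C.toSubmodule ⊓ σ.fixedPoints L)) :=
  ⟨{ toFun := fun v => ⟨(v : C.toSubmodule), Submodule.mem_inf.2 ⟨v.1.2,
        (mem_fixedPoints_toRepresentation_iff C L v.1).1 v.2⟩⟩
     invFun := fun u => ⟨⟨u, (Submodule.mem_inf.1 u.2).1⟩,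
        (mem_fixedPoints_toRepresentation_iff C L _).2 (Submodule.mem_inf.1 u.2).2⟩
     map_add' := fun _ _ => rfl
     map_smul' := fun _ _ => rfl
     left_inv := fun _ => rfl
     right_inv := fun _ => rfl }⟩

/-- A subrepresentation of a smooth representation is smooth. [folklore] -/
theorem isSmooth_toRepresentation_of_isSmooth [TopologicalSpace H] (hσ : σ.IsSmooth) :
    C.toRepresentation.IsSmooth := by
  intro v
  have : ((C.toRepresentation.stabilizerSubgroup v : Subgroup H) : Set H) =
      (σ.stabilizerSubgroup (v : W) : Set H) := by
    ext g
    simp only [SetLike.mem_coe, Representation.mem_stabilizerSubgroup,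
      Subrepresentation.toRepresentation, MonoidHom.coe_mk, OneHom.coe_mk, Subtype.ext_iff,
      LinearMap.coe_restrict_apply]
  rw [Representation.IsSmoothVector, this]
  exact hσ v

/-- **Irreducibility on the subtype.** If the only `H`-stable subspaces of the (non-zero) carrier
of a subrepresentation `C` are `⊥` and `C`, then `C.toRepresentation` is irreducible in Mathlib's
sense (`IsSimpleOrder` of its subrepresentations). [folklore] -/
theorem isIrreducible_toRepresentation_of_submodule (h0 : C.toSubmodule ≠ ⊥)
    (hirr : ∀ X : Submodule k W, X ≤ C.toSubmodule → (∀ h : H, ∀ x ∈ X, σ h x ∈ X) →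
      X = ⊥ ∨ X = C.toSubmodule) :
    C.toRepresentation.IsIrreducible := by
  obtain ⟨v, hv, hv0⟩ := Submodule.exists_mem_ne_zero_of_ne_bot h0
  refine { toNontrivial := ⟨⟨⊥, ⊤, fun hbt => ?_⟩⟩, eq_bot_or_eq_top := fun X' => ?_ }
  · have : (⟨v, hv⟩ : C.toSubmodule) ∈ (⊥ : Subrepresentation C.toRepresentation).toSubmodule := by
      rw [hbt]
      trivial
    exact hv0 (congrArg Subtype.val ((Submodule.mem_bot k).1 this))
  · set X : Submodule k W := X'.toSubmodule.map C.toSubmodule.subtype with hX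
    have hXC : X ≤ C.toSubmodule := by
      rintro _ ⟨x, -, rfl⟩
      exact x.2
    have hXst : ∀ h : H, ∀ x ∈ X, σ h x ∈ X := by
      rintro h _ ⟨x, hx, rfl⟩
      exact ⟨C.toRepresentation h x, X'.apply_mem_toSubmodule h hx, rfl⟩
    rcases hirr X hXC hXst with hb | ht
    · left
      refine Subrepresentation.toSubmodule_injective ((Submodule.eq_bot_iff _).2 fun x hx => ?_)
      have : (x : W) ∈ X := ⟨x, hx, rfl⟩
      rw [hb, Submodule.mem_bot] at this
      exact Subtype.ext this
    · right
      refine Subrepresentation.toSubmodule_injective (Submodule.eq_top_iff'.2 fun x => ?_)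
      have : (x : W) ∈ X := by
        rw [ht]
        exact x.2
      obtain ⟨y, hy, hyx⟩ := this
      have : y = x := Subtype.ext hyx
      exact this ▸ hy

end Subrep

/-! ### Products of commuting operator families (`Finset.noncommProd`) -/

section NoncommProd

variable {k W : Type*} [Field k] [AddCommGroup W] [Module k W] {ι : Type*}
  (A : ι → Submodule k (W →ₗ[k] W))
  (hA : ∀ {i j : ι}, i ≠ j → ∀ S ∈ A i, ∀ T ∈ A j, S * T = T * S)

include hA in
/-- A family `f i ∈ A i` taken from pairwise commuting spaces of operators commutes pairwise. [folklore] -/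
theorem pairwise_commute_of_mem {f : ι → W →ₗ[k] W} (hf : ∀ i, f i ∈ A i) (s : Set ι) :
    s.Pairwise (Commute on f) := fun i _ j _ hij => hA hij _ (hf i) _ (hf j)

/-- **Independence of the representatives.** Let `f i, f' i ∈ A i` (pairwise commuting spaces of
operators) agree on a vector `w` for `i ∈ F`, and let `T` commute with the `A i`, `i ∈ F`. Then
`(∏_{i ∈ F} f i) (T w) = (∏_{i ∈ F} f' i) (T w)`: move one factor through the others to act
first. (The well-definedness of pure tensors `⊗ x_i ↦ (∏ T_i) w⋆` in the internal construction of
the restricted tensor product; cf. Flath 1979, §2, Bump 1997, §3.3.) [folklore] -/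
theorem noncommProd_apply_eq_of_apply_eq [DecidableEq ι] (F : Finset ι) {f f' : ι → W →ₗ[k] W}
    (hf : ∀ i, f i ∈ A i) (hf' : ∀ i, f' i ∈ A i) (w : W) (hw : ∀ i ∈ F, f i w = f' i w)
    (T : W →ₗ[k] W) (hT : ∀ i ∈ F, ∀ S ∈ A i, T * S = S * T) :
    F.noncommProd f (pairwise_commute_of_mem A hA hf _) (T w) =
      F.noncommProd f' (pairwise_commute_of_mem A hA hf' _) (T w) := by
  induction F using Finset.induction_on generalizing T with
  | empty => simp
  | insert a F ha ih =>
    rw [Finset.noncommProd_insert_of_notMem _ _ _ _ ha,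
      Finset.noncommProd_insert_of_notMem _ _ _ _ ha]
    have hc : Commute (f a) (F.noncommProd f (pairwise_commute_of_mem A hA hf _)) :=
      Finset.noncommProd_commute _ _ _ _ fun x hx =>
        hA (i := a) (j := x) (fun h => ha (h ▸ hx)) _ (hf a) _ (hf x)
    have hc' : Commute (f' a) (F.noncommProd f' (pairwise_commute_of_mem A hA hf' _)) :=
      Finset.noncommProd_commute _ _ _ _ fun x hx =>
        hA (i := a) (j := x) (fun h => ha (h ▸ hx)) _ (hf' a) _ (hf' x)
    rw [hc.eq, hc'.eq, Module.End.mul_apply, Module.End.mul_apply, ← Module.End.mul_apply (f a) T,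
      ← Module.End.mul_apply (f' a) T,
      ← hT a (Finset.mem_insert_self a F) _ (hf a), ← hT a (Finset.mem_insert_self a F) _ (hf' a),
      Module.End.mul_apply, Module.End.mul_apply, hw a (Finset.mem_insert_self a F),
      ← Module.End.mul_apply T (f' a)]
    refine ih (fun i hi => hw i (Finset.mem_insert_of_mem hi)) (T * f' a) fun i hi S hS => ?_
    rw [mul_assoc, hA (i := a) (j := i) (fun h => ha (h ▸ hi)) _ (hf' a) _ hS, ← mul_assoc,
      hT i (Finset.mem_insert_of_mem hi) S hS, mul_assoc]

/-- If every factor fixes `w`, so does the product. [folklore] -/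
theorem noncommProd_apply_eq_self (F : Finset ι) {f : ι → W →ₗ[k] W} (hf : ∀ i, f i ∈ A i)
    (w : W) (hw : ∀ i ∈ F, f i w = w) :
    F.noncommProd f (pairwise_commute_of_mem A hA hf _) w = w := by
  classical
  induction F using Finset.induction_on with
  | empty => simp
  | insert a F ha ih =>
    rw [Finset.noncommProd_insert_of_notMem _ _ _ _ ha, Module.End.mul_apply,
      ih fun i hi => hw i (Finset.mem_insert_of_mem hi), hw a (Finset.mem_insert_self a F)]

/-- Enlarging the finite set by factors fixing `w` does not change the value at `w`. [folklore] -/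
theorem noncommProd_apply_eq_of_subset [DecidableEq ι] {F F' : Finset ι} (hFF' : F ⊆ F')
    {f : ι → W →ₗ[k] W} (hf : ∀ i, f i ∈ A i) (w : W) (hw : ∀ i ∈ F', i ∉ F → f i w = w) :
    F'.noncommProd f (pairwise_commute_of_mem A hA hf _) w =
      F.noncommProd f (pairwise_commute_of_mem A hA hf _) w := by
  have hunion : F' = F ∪ (F' \ F) := (Finset.union_sdiff_of_subset hFF').symm
  rw [Finset.noncommProd_congr hunion (fun _ _ => rfl) (pairwise_commute_of_mem A hA hf _),
    Finset.noncommProd_union_of_disjoint Finset.disjoint_sdiff, Module.End.mul_apply,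
    noncommProd_apply_eq_self A hA _ hf w fun i hi => ?_]
  exact hw i (Finset.mem_sdiff.1 hi).1 (Finset.mem_sdiff.1 hi).2

end NoncommProd

/-! ### The coordinate algebras `A_i = span π(ι_i G_i)` and the cyclic modules `C_i(w)` -/

section CoordSpan

variable {ι : Type u} [DecidableEq ι] {G : ι → Type v} [∀ i, Group (G i)]
  {K : ∀ i, Subgroup (G i)} {k : Type uk} [Field k] {W : Type w} [AddCommGroup W] [Module k W]
  (π : Representation k (Πʳ i, [G i, K i]) W)

/-- An operator in `A_i = span {π(ι_i g)}` commutes with `π(d)` whenever `d` has trivial `i`-th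
coordinate. [folklore] -/
theorem mul_apply_eq_of_mem_coordSpan {i : ι} {T : W →ₗ[k] W}
    (hT : T ∈ Submodule.span k (Set.range fun g : G i => π (mulSingleHom K i g)))
    {d : Πʳ i, [G i, K i]} (hd : d i = 1) : T * π d = π d * T := by
  induction hT using Submodule.span_induction with
  | mem x hx =>
    obtain ⟨g, rfl⟩ := hx
    rw [← map_mul, ← map_mul]
    exact congrArg π (mul_mulSingle_comm_of_apply_eq_one hd g).symm
  | zero => simp
  | add x y _ _ hx hy => rw [add_mul, mul_add, hx, hy]
  | smul a x _ hx => rw [smul_mul_assoc, mul_smul_comm, hx]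

/-- Operators in `A_i` and `A_j`, `i ≠ j`, commute. [folklore] -/
theorem mul_comm_of_mem_coordSpan {i j : ι} (hij : i ≠ j) :
    ∀ S ∈ Submodule.span k (Set.range fun g : G i => π (mulSingleHom K i g)),
    ∀ T ∈ Submodule.span k (Set.range fun g : G j => π (mulSingleHom K j g)), S * T = T * S := by
  intro S hS T hT
  induction hT using Submodule.span_induction with
  | mem x hx =>
    obtain ⟨g, rfl⟩ := hx
    exact mul_apply_eq_of_mem_coordSpan π hS (RestrictedProduct.mulSingle_eq_of_ne' K g hij.symm)
  | zero => simp
  | add x y _ _ hx hy => rw [add_mul, mul_add, hx, hy]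
  | smul a x _ hx => rw [smul_mul_assoc, mul_smul_comm, hx]

/-- `π(ι_i h) ∈ A_i`. [folklore] -/
theorem apply_mulSingleHom_mem_coordSpan (i : ι) (h : G i) :
    π (mulSingleHom K i h) ∈ Submodule.span k (Set.range fun g : G i => π (mulSingleHom K i g)) :=
  Submodule.subset_span ⟨h, rfl⟩

/-- `A_i` is stable under left multiplication by `π(ι_i h)`. [folklore] -/
theorem mulSingleHom_mul_mem_coordSpan (i : ι) (h : G i) {T : W →ₗ[k] W}
    (hT : T ∈ Submodule.span k (Set.range fun g : G i => π (mulSingleHom K i g))) :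
    π (mulSingleHom K i h) * T ∈ Submodule.span k (Set.range fun g : G i => π (mulSingleHom K i g)) := by
  induction hT using Submodule.span_induction with
  | mem x hx =>
    obtain ⟨g, rfl⟩ := hx
    rw [← map_mul, ← map_mul]
    exact Submodule.subset_span ⟨h * g, rfl⟩
  | zero => simp
  | add x y _ _ hx hy =>
    rw [mul_add]
    exact Submodule.add_mem _ hx hy
  | smul a x _ hx =>
    rw [mul_smul_comm]
    exact Submodule.smul_mem _ a hx

/-- Every vector of the cyclic module `C_i(w)` is `T w` for some `T ∈ A_i`. [folklore] -/
theorem exists_mem_coordSpan_apply_eq (i : ι) (w : W) {v : W}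
    (hv : v ∈ Submodule.span k (Set.range fun g : G i => π (mulSingleHom K i g) w)) :
    ∃ T ∈ Submodule.span k (Set.range fun g : G i => π (mulSingleHom K i g)), T w = v := by
  induction hv using Submodule.span_induction with
  | mem x hx =>
    obtain ⟨g, rfl⟩ := hx
    exact ⟨_, apply_mulSingleHom_mem_coordSpan π i g, rfl⟩
  | zero => exact ⟨0, Submodule.zero_mem _, rfl⟩
  | add x y _ _ hx hy =>
    obtain ⟨S, hS, rfl⟩ := hx
    obtain ⟨T, hT, rfl⟩ := hy
    exact ⟨S + T, Submodule.add_mem _ hS hT, rfl⟩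
  | smul a x _ hx =>
    obtain ⟨T, hT, rfl⟩ := hx
    exact ⟨a • T, Submodule.smul_mem _ a hT, rfl⟩

/-- `T w ∈ C_i(w)` for `T ∈ A_i`. [folklore] -/
theorem apply_mem_span_of_mem_coordSpan (i : ι) (w : W) {T : W →ₗ[k] W}
    (hT : T ∈ Submodule.span k (Set.range fun g : G i => π (mulSingleHom K i g))) :
    T w ∈ Submodule.span k (Set.range fun g : G i => π (mulSingleHom K i g) w) := by
  induction hT using Submodule.span_induction with
  | mem x hx =>
    obtain ⟨g, rfl⟩ := hx
    exact Submodule.subset_span ⟨g, rfl⟩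
  | zero => simp
  | add x y _ _ hx hy =>
    rw [LinearMap.add_apply]
    exact Submodule.add_mem _ hx hy
  | smul a x _ hx =>
    rw [LinearMap.smul_apply]
    exact Submodule.smul_mem _ a hx

/-- Coordinates of a finite product of coordinate embeddings. [folklore] -/
theorem noncommProd_mulSingleHom_apply (F : Finset ι) (g : ∀ i, G i)
    (comm : (F : Set ι).Pairwise (Commute on fun i => mulSingleHom K i (g i))) (j : ι) :
    (F.noncommProd (fun i => mulSingleHom K i (g i)) comm) j = if j ∈ F then g j else 1 := by
  classical
  induction F using Finset.induction_on with
  | empty => simp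
  | insert a F ha ih =>
    rw [Finset.noncommProd_insert_of_notMem _ _ _ _ ha, RestrictedProduct.mul_apply,
      ih (comm.mono fun _ => Finset.mem_insert_of_mem), mulSingleHom_apply_apply]
    by_cases hj : j = a
    · subst hj
      simp [ha]
    · simp [hj]

end CoordSpan

/-! ### The discharge -/

section Discharge

variable {ι : Type u} [DecidableEq ι] {G : ι → Type v} [∀ i, Group (G i)]
  [∀ i, TopologicalSpace (G i)] {K : ∀ i, Subgroup (G i)}
  {W : Type w} [AddCommGroup W] [Module ℂ W]

/-- **lang.S19 — Flath's tensor product theorem, existence, for topological groups.** Let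
`(G i)` be topological groups with compact open subgroups `K i` such that `(G i, K i)` is a
Gelfand pair for all but finitely many `i`. Then every irreducible admissible representation `π`
of `Πʳ i, [G i, K i]` on `W` is a restricted tensor product `π ≅ ⊗'_i (ρ i, x₀ i)` of irreducible
admissible representations `ρ i` of the `G i`, with `ρ i` spherical and `x₀ i` a non-zero
`K i`-fixed vector for almost all `i` — i.e. the named fact `flath_exists` holds for every family
of *topological groups*. The local factors are the cyclic `G i`-modules
`C_i = span {π(ι_i g) w⋆} ≤ W` of the purified base vector `w⋆` of `exists_flathBaseVector`,
`x₀ i = w⋆`, and `j x = (∏_{i : x i ≠ w⋆} T_i) w⋆` with `T_i ∈ A_i`, `T_i w⋆ = x i` (see the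
module docstring). The source states the theorem for totally disconnected locally compact
groups (Flath 1979, Example 2: "T.D. groups"), which are topological groups; local compactness,
Hausdorffness and total disconnectedness are not used beyond the compactness and openness of the
`K i`. (Flath 1979, Thm. 3 with Thm. 2 and Example 2; Bump 1997, Thm. 3.4.4 with Prop. 3.4.9.)
[cite: FlathCorvallis1979, Theorem 3] -/
theorem flath_exists_holds_of_isTopologicalGroup [∀ i, IsTopologicalGroup (G i)] :
    flath_exists (ι := ι) (G := G) (K := K) (W := W) := by
  intro hK hKc hGP π hirr hadm
  classical
  haveI := hirr
  haveI : Fact (∀ i, IsOpen (K i : Set (G i))) := ⟨hK⟩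
  have hπ : π.IsSmooth := hadm.1
  obtain ⟨L, w, hLo, hLc, hLK, hLK', hwU, hw0, hirrC, hsph⟩ :=
    exists_flathBaseVector π hK hKc hGP hadm
  -- notation-free abbreviations
  let C : ∀ i, Submodule ℂ W := fun i =>
    Submodule.span ℂ (Set.range fun g : G i => π (mulSingleHom K i g) w)
  let A : ∀ i, Submodule ℂ (W →ₗ[ℂ] W) := fun i =>
    Submodule.span ℂ (Set.range fun g : G i => π (mulSingleHom K i g))
  have hA : ∀ {i j : ι}, i ≠ j → ∀ S ∈ A i, ∀ T ∈ A j, S * T = T * S :=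
    fun hij => mul_comm_of_mem_coordSpan π hij
  have hCst : ∀ i (h : G i), ∀ c ∈ C i, π (mulSingleHom K i h) c ∈ C i :=
    fun i h c hc => apply_mem_span_range_mulSingleHom π i w h hc
  let Cs : ∀ i, Subrepresentation (π.comp (mulSingleHom K i)) := fun i => ⟨C i, hCst i⟩
  let V : ι → Type w := fun i => ↥(C i)
  let ρ : ∀ i, Representation ℂ (G i) (V i) := fun i => (Cs i).toRepresentation
  have hρ_apply : ∀ i (g : G i) (v : V i), (ρ i g v : W) = π (mulSingleHom K i g) (v : W) :=
    fun i g v => rfl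
  have hwC : ∀ i, w ∈ C i := fun i => self_mem_span_range_mulSingleHom π i w
  let x₀ : ∀ i, V i := fun i => ⟨w, hwC i⟩
  -- `w` is `K i`-fixed for almost all `i`, `U`-fixed vectors are `ι_i(L i)`-fixed
  have hwL : ∀ i, w ∈ Representation.fixedPoints (π.comp (mulSingleHom K i)) (L i) :=
    fun i => fixedPoints_boxSubgroup_le π L i hwU
  have hx₀ : ∀ᶠ i in cofinite, x₀ i ∈ (ρ i).fixedPoints (K i) := by
    refine hLK'.mono fun i hi => ?_
    rw [mem_fixedPoints_toRepresentation_iff]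
    exact hi ▸ hwL i
  -- representatives and the structure map `j`
  have hrep : ∀ i (v : V i), ∃ T ∈ A i, T w = v := fun i v =>
    exists_mem_coordSpan_apply_eq π i w v.2
  choose rep hrepA hrepw using hrep
  have hfin : ∀ x : RestrictedFamily V x₀, {i | x i ≠ x₀ i}.Finite := fun x => by
    have := x.eventually_eq
    exact Filter.eventually_cofinite.1 this
  let Fx : RestrictedFamily V x₀ → Finset ι := fun x => (hfin x).toFinset
  have hFx : ∀ x i, i ∉ Fx x → x i = x₀ i := fun x i hi => by
    by_contra h
    exact hi ((hfin x).mem_toFinset.2 h)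
  let j : RestrictedFamily V x₀ → W := fun x =>
    (Fx x).noncommProd (fun i => rep i (x i))
      (pairwise_commute_of_mem A hA (fun i => hrepA i (x i)) _) w
  -- **Lemma B**: `j x` computed with any large finite set and any representatives
  have j_eq : ∀ (x : RestrictedFamily V x₀) (F : Finset ι), Fx x ⊆ F →
      ∀ (f : ι → W →ₗ[ℂ] W) (hf : ∀ i, f i ∈ A i), (∀ i ∈ F, f i w = x i) →
        j x = F.noncommProd f (pairwise_commute_of_mem A hA hf _) w := by
    intro x F hF f hf hfw
    have h1 : j x = (Fx x).noncommProd f (pairwise_commute_of_mem A hA hf _) w := by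
      have := noncommProd_apply_eq_of_apply_eq A hA (Fx x) (fun i => hrepA i (x i)) hf w
        (fun i hi => by rw [hrepw, hfw i (hF hi)]) 1 (fun i _ S _ => by rw [one_mul, mul_one])
      simpa using this
    rw [h1, noncommProd_apply_eq_of_subset A hA hF hf w fun i hi hi' => ?_]
    rw [hfw i hi, hFx x i hi']
  have one_mem_A : ∀ i, (1 : W →ₗ[ℂ] W) ∈ A i := fun i => by
    have := apply_mulSingleHom_mem_coordSpan π i (1 : G i)
    rwa [map_one, map_one] at this
  have j_base : j (RestrictedFamily.base x₀) = w := by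
    have hFb : Fx (RestrictedFamily.base x₀) ⊆ ∅ := fun i hi =>
      absurd ((hfin _).mem_toFinset.1 hi) (by simp)
    rw [j_eq _ ∅ hFb (fun _ => 1) one_mem_A (fun i hi => absurd hi (Finset.notMem_empty i)),
      Finset.noncommProd_empty, Module.End.one_apply]
  -- **updating one coordinate**: `j (x.update i v) = T p` for any representative `T` of `v`
  have j_update : ∀ (x : RestrictedFamily V x₀) (i : ι), ∃ p : W,
      ∀ (T : W →ₗ[ℂ] W), T ∈ A i → ∀ v : V i, T w = v → j (x.update i v) = T p := by
    intro x i
    let s : Finset ι := insert i (Fx x)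
    have his : i ∈ s := Finset.mem_insert_self i _
    refine ⟨(s.erase i).noncommProd (fun l => rep l (x l))
      (pairwise_commute_of_mem A hA (fun l => hrepA l (x l)) _) w, fun T hT v hTv => ?_⟩
    let fT : ι → W →ₗ[ℂ] W := Function.update (fun l => rep l (x l)) i T
    have hfT : ∀ l, fT l ∈ A l := fun l => by
      by_cases hl : l = i
      · subst hl
        simp [fT, hT]
      · simp [fT, Function.update_of_ne hl, hrepA]
    have hsub : Fx (x.update i v) ⊆ s := fun l hl => by
      have hl' : (x.update i v) l ≠ x₀ l := (hfin _).mem_toFinset.1 hl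
      by_cases hli : l = i
      · subst hli
        exact Finset.mem_insert_self l _
      · refine Finset.mem_insert_of_mem ((hfin x).mem_toFinset.2 ?_)
        rwa [RestrictedFamily.update_apply, Function.update_of_ne hli] at hl'
    have hfw : ∀ l ∈ s, fT l w = (x.update i v) l := fun l _ => by
      by_cases hli : l = i
      · subst hli
        simp [fT, hTv]
      · simp [fT, Function.update_of_ne hli, hrepw]
    rw [j_eq (x.update i v) s hsub fT hfT hfw,
      ← Finset.mul_noncommProd_erase s his fT (pairwise_commute_of_mem A hA hfT _), Module.End.mul_apply]
    simp only [fT, Function.update_self]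
    congr 1
    refine congrFun (congrArg DFunLike.coe (Finset.noncommProd_congr rfl (fun l hl => ?_) _)) w
    rw [Function.update_of_ne (Finset.ne_of_mem_erase hl)]
  have hjm : IsRestrictedMultilinear ℂ j :=
    { map_update_add := fun x i v₁ v₂ => by
        obtain ⟨p, hp⟩ := j_update x i
        rw [hp (rep i v₁ + rep i v₂) (Submodule.add_mem _ (hrepA i v₁) (hrepA i v₂)) (v₁ + v₂)
            (by rw [LinearMap.add_apply, hrepw, hrepw, Submodule.coe_add]),
          hp (rep i v₁) (hrepA i v₁) v₁ (hrepw i v₁), hp (rep i v₂) (hrepA i v₂) v₂ (hrepw i v₂),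
          LinearMap.add_apply]
      map_update_smul := fun x i c v => by
        obtain ⟨p, hp⟩ := j_update x i
        rw [hp (c • rep i v) (Submodule.smul_mem _ c (hrepA i v)) (c • v)
            (by rw [LinearMap.smul_apply, hrepw, Submodule.coe_smul]),
          hp (rep i v) (hrepA i v) v (hrepw i v), LinearMap.smul_apply] }
  -- **equivariance**
  have hequiv : ∀ (g : Πʳ i, [G i, K i]) (x : RestrictedFamily V x₀),
      j (RestrictedFamily.smul ρ hx₀ g x) = π g (j x) := by
    intro g x
    have hE : {l | g l ∉ L l}.Finite := by
      refine Filter.eventually_cofinite.1 ((g.2.and hLK').mono fun l hl => ?_)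
      rw [hl.2]
      exact hl.1
    let F : Finset ι := Fx x ∪ hE.toFinset
    have hgL : ∀ l ∉ F, g l ∈ L l := fun l hl => by
      by_contra h
      exact hl (Finset.mem_union_right _ (hE.mem_toFinset.2 h))
    have hFxF : Fx x ⊆ F := Finset.subset_union_left
    -- `j (g • x)` with the representatives `π(ι_l (g l)) * rep l (x l)`
    let f₁ : ι → W →ₗ[ℂ] W := fun l => π (mulSingleHom K l (g l))
    let f₂ : ι → W →ₗ[ℂ] W := fun l => rep l (x l)
    have hf₁ : ∀ l, f₁ l ∈ A l := fun l => apply_mulSingleHom_mem_coordSpan π l (g l)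
    have hf₂ : ∀ l, f₂ l ∈ A l := fun l => hrepA l (x l)
    have hf₁₂ : ∀ l, (f₁ * f₂) l ∈ A l := fun l => mulSingleHom_mul_mem_coordSpan π l (g l) (hf₂ l)
    have hsub : Fx (RestrictedFamily.smul ρ hx₀ g x) ⊆ F := fun l hl => by
      by_contra hlF
      have hl' : (RestrictedFamily.smul ρ hx₀ g x) l ≠ x₀ l := (hfin _).mem_toFinset.1 hl
      apply hl'
      rw [RestrictedFamily.smul_apply, hFx x l (fun h => hlF (hFxF h))]
      refine Subtype.ext ?_
      rw [hρ_apply]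
      exact (Representation.mem_fixedPoints _ _ _).1 (hwL l) (g l) (hgL l hlF)
    have h1 : j (RestrictedFamily.smul ρ hx₀ g x) =
        F.noncommProd (f₁ * f₂) (pairwise_commute_of_mem A hA hf₁₂ _) w :=
      j_eq _ F hsub (f₁ * f₂) hf₁₂ fun l _ => by
        simp only [Pi.mul_apply, Module.End.mul_apply, f₁, f₂, hrepw, RestrictedFamily.smul_apply,
          hρ_apply]
    have h2 : j x = F.noncommProd f₂ (pairwise_commute_of_mem A hA hf₂ _) w :=
      j_eq x F hFxF f₂ hf₂ fun l _ => hrepw l (x l)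
    have hcomm_gf : (F : Set ι).Pairwise fun a b => Commute (f₂ a) (f₁ b) :=
      fun a _ b _ hab => hA hab _ (hf₂ a) _ (hf₁ b)
    rw [h1, h2, Finset.noncommProd_mul_distrib f₁ f₂ (pairwise_commute_of_mem A hA hf₁ _)
      (pairwise_commute_of_mem A hA hf₂ _) hcomm_gf, Module.End.mul_apply]
    -- `∏_{l ∈ F} π(ι_l (g l)) = π(g_F)`, `g = g_F · c` with `c ∈ U` trivial on `F`
    have commF : (F : Set ι).Pairwise (Commute on fun l => mulSingleHom K l (g l)) :=
      fun a _ b _ hab => mulSingle_commute_of_ne hab (g a) (g b)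
    set gF : Πʳ i, [G i, K i] := F.noncommProd (fun l => mulSingleHom K l (g l)) commF with hgF
    have h3 : F.noncommProd f₁ (pairwise_commute_of_mem A hA hf₁ _) = π gF :=
      (Finset.map_noncommProd F (fun l => mulSingleHom K l (g l)) commF π).symm
    have hgF_apply : ∀ l, gF l = if l ∈ F then g l else 1 :=
      noncommProd_mulSingleHom_apply F (fun l => g l) commF
    set c : Πʳ i, [G i, K i] := gF⁻¹ * g with hc
    have hc_apply : ∀ l, c l = if l ∈ F then 1 else g l := fun l => by
      rw [hc, RestrictedProduct.mul_apply, RestrictedProduct.inv_apply, hgF_apply]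
      split_ifs with h
      · rw [inv_mul_cancel]
      · rw [inv_one, one_mul]
    have hcU : c ∈ boxSubgroup (K := K) L := fun l => by
      rw [hc_apply]
      split_ifs with h
      · exact (L l).one_mem
      · exact hgL l h
    have hPc : Commute (π c) (F.noncommProd f₂ (pairwise_commute_of_mem A hA hf₂ _)) :=
      Finset.noncommProd_commute F f₂ _ (π c) fun l hl =>
        (mul_apply_eq_of_mem_coordSpan π (hf₂ l) (by rw [hc_apply, if_pos hl])).symm
    have hg : g = gF * c := by rw [hc, mul_inv_cancel_left]
    have hcw : π c w = w := (Representation.mem_fixedPoints _ _ _).1 hwU c hcU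
    rw [h3]
    set P : W →ₗ[ℂ] W := F.noncommProd f₂ (pairwise_commute_of_mem A hA hf₂ _) with hP
    calc π gF (P w) = π gF (P (π c w)) := by rw [hcw]
      _ = π gF (π c (P w)) := by
          rw [← Module.End.mul_apply P (π c) w, ← hPc.eq, Module.End.mul_apply]
      _ = π (gF * c) (P w) := by rw [map_mul π gF c, Module.End.mul_apply]
      _ = π g (P w) := by rw [← hg]
  -- **the local factors are irreducible and admissible; almost all spherical**
  have hρirr : ∀ i, (ρ i).IsIrreducible := fun i =>
    isIrreducible_toRepresentation_of_submodule (Cs i) (span_range_mulSingleHom_ne_bot π i hw0) (hirrC i)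
  have hCle : ∀ i, C i ≤ π.fixedPoints (boxSubgroup (Function.update L i ⊥)) := fun i =>
    span_range_mulSingleHom_le_fixedPoints_update_bot π L i
      (mem_fixedPoints_boxSubgroup_update_bot π L i hwU)
  have hρadm : ∀ i, (ρ i).IsAdmissible := fun i => by
    refine ⟨isSmooth_toRepresentation_of_isSmooth (Cs i) (isSmooth_comp_mulSingleHom π hπ i), fun K' hK'c => ?_⟩
    let L' : Subgroup (G i) := (K' : Subgroup (G i)) ⊓ L i
    have hL'o : IsOpen (L' : Set (G i)) := K'.isOpen.inter (hLo i)
    have hL'c : IsCompact (L' : Set (G i)) := (hLc i).inter_left K'.isClosed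
    have hL'K : L' ≤ K i := inf_le_right.trans (hLK i)
    haveI := finite_fixedPoints_boxSubgroup_update π hadm hLo hLc hLK hLK' i hL'o hL'c hL'K
    have hle : C i ⊓ Representation.fixedPoints (π.comp (mulSingleHom K i)) L' ≤
        π.fixedPoints (boxSubgroup (Function.update L i L')) := fun v hv =>
      (mem_fixedPoints_boxSubgroup_update_iff π L i L' v).2
        ⟨hCle i (Submodule.mem_inf.1 hv).1, (Submodule.mem_inf.1 hv).2⟩
    haveI : Module.Finite ℂ ↥(C i ⊓ Representation.fixedPoints (π.comp (mulSingleHom K i)) L') :=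
      Submodule.finiteDimensional_of_le hle
    obtain ⟨e⟩ := nonempty_fixedPoints_toRepresentation_equiv (Cs i) L'
    haveI : Module.Finite ℂ ↥((ρ i).fixedPoints L') := Module.Finite.equiv e.symm
    exact Submodule.finiteDimensional_of_le
      (Representation.fixedPoints_antitone (ρ i) (inf_le_left : L' ≤ (K' : Subgroup (G i))))
  have hsph' : ∀ᶠ i in cofinite, (ρ i).IsSpherical (K i) ∧ x₀ i ≠ 0 := by
    refine hsph.mono fun i hi => ⟨?_, fun h => hw0 (congrArg Subtype.val h)⟩
    obtain ⟨e⟩ := nonempty_fixedPoints_toRepresentation_equiv (Cs i) (K i)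
    rw [Representation.isSpherical_iff, LinearEquiv.finrank_eq e]
    change Module.finrank ℂ ↥(C i ⊓ Representation.fixedPoints (π.comp (mulSingleHom K i)) (K i)) = 1
    rw [hi, finrank_span_singleton hw0]
  -- **injectivity of the finite-level maps** (every finite `S`)
  have hinj : ∀ S : Finset ι, Function.Injective (hjm.liftFinset S) := by
    intro S
    rw [← LinearMap.ker_eq_bot]
    by_contra hker
    have hd : ∀ (i : S) (s : Finset (V i)) (f : V i →ₗ[ℂ] V i),
        ∃ r : MonoidAlgebra ℂ (G i), ∀ m ∈ s, (ρ i).asAlgebraHom r m = f m := fun i =>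
      haveI := hρirr i
      Representation.exists_asAlgebraHom_apply_eq fun T hT =>
        (hρadm i).exists_eq_smul_id (hK i) (hKc i) T hT
    have hstab : ∀ (g : ∀ i : S, G i), ∀ t ∈ LinearMap.ker (hjm.liftFinset S),
        map (fun i : S => ρ i (g i)) t ∈ LinearMap.ker (hjm.liftFinset S) := by
      intro g t ht
      let g' : Πʳ i, [G i, K i] :=
        RestrictedProduct.mk (fun i => if hi : i ∈ S then g ⟨i, hi⟩ else 1)
          (S.eventually_cofinite_notMem.mono fun i hi => by simp [hi])
      have hg' : (fun i : S => ρ i (g i)) = fun i : S => ρ i (g' i) := by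
        funext i
        change ρ i (g i) = ρ i (if hi : (i : ι) ∈ S then g ⟨i, hi⟩ else 1)
        rw [dif_pos i.2]
      have hg'' : ∀ i ∉ S, ρ i (g' i) (x₀ i) = x₀ i := fun i hi => by
        change ρ i (if hi : (i : ι) ∈ S then g ⟨i, hi⟩ else 1) (x₀ i) = x₀ i
        rw [dif_neg hi, map_one, Module.End.one_apply]
      rw [LinearMap.mem_ker] at ht ⊢
      rw [hg', hjm.liftFinset_map_eq hequiv S g' hg'' t, ht, map_zero]
    have htop := piTensorProduct_submodule_eq_top (fun i : S => ρ i) hd hstab hker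
    have hmem : (tprod ℂ fun i : S => x₀ i) ∈ LinearMap.ker (hjm.liftFinset S) :=
      htop ▸ Submodule.mem_top
    rw [LinearMap.mem_ker, IsRestrictedMultilinear.liftFinset_tprod] at hmem
    have hext : RestrictedFamily.extend S (fun i : S => x₀ (i : ι)) = RestrictedFamily.base x₀ := by
      refine DFunLike.ext _ _ fun i => ?_
      by_cases hi : i ∈ S
      · rw [RestrictedFamily.extend_apply_of_mem _ _ hi, RestrictedFamily.base_apply]
      · rw [RestrictedFamily.extend_apply_of_notMem _ _ hi, RestrictedFamily.base_apply]
    rw [hext, j_base] at hmem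
    exact hw0 hmem
  -- **exhaustion**
  have hsup : ⨆ S : Finset ι, LinearMap.range (hjm.liftFinset S) = ⊤ := by
    have hN : Submodule.span ℂ (Set.range j) ≤ ⨆ S : Finset ι, LinearMap.range (hjm.liftFinset S) := by
      rw [Submodule.span_le]
      rintro _ ⟨x, rfl⟩
      exact Submodule.mem_iSup_of_mem (Fx x) (hjm.apply_mem_range_liftFinset (Fx x) x (hFx x))
    obtain ⟨U', hU'⟩ : ∃ U' : Subrepresentation π, U'.toSubmodule = Submodule.span ℂ (Set.range j) :=
      ⟨⟨Submodule.span ℂ (Set.range j), fun g v hv => by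
          have h := Submodule.mem_map_of_mem (f := π g) hv
          rw [Submodule.map_span] at h
          refine Submodule.span_mono ?_ h
          rintro _ ⟨_, ⟨x, rfl⟩, rfl⟩
          exact ⟨RestrictedFamily.smul ρ hx₀ g x, hequiv g x⟩⟩, rfl⟩
    have hU'0 : U' ≠ ⊥ := fun h => by
      have : w ∈ U'.toSubmodule := hU' ▸ (j_base ▸ Submodule.subset_span ⟨_, rfl⟩)
      rw [h] at this
      exact hw0 ((Submodule.mem_bot ℂ).1 this)
    have hU'top : U' = ⊤ := (IsSimpleOrder.eq_bot_or_eq_top U').resolve_left hU'0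
    have hNtop : Submodule.span ℂ (Set.range j) = ⊤ := by rw [← hU', hU'top]; rfl
    exact eq_top_iff.2 (hNtop ▸ hN)
  exact ⟨V, inferInstance, inferInstance, ρ, x₀, hx₀, j, ∅,
    ⟨⟨hjm, fun S _ => hinj S, hsup⟩, hequiv⟩, fun i => ⟨hρirr i, hρadm i⟩, hsph'⟩

end Discharge

end Literature.NumberTheory.Automorphic
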